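import Mathlib
import Summits.ValiantsHypothesis.ValiantsHypothesis.Theorems.BarrierLeverPrincipalMinorLayoutsCapacityBound

/-!
# Route BarrierLever — the UNIVERSAL-CERTIFICATE CAPACITY BARRIER for partition-minor layouts

Support file (`--supports stmt-ValiantsHypothesis-19717`, item `PartitionMinorsHitByVP`; cell
valiant-natproofs, rung V4, 𝒟-side; prover seat val-np-p3 gen 4). Definition-free. This is the
general TEMPLATE behind the kernel refutation of TNS (`TNSRefutation.not_PrincipalMinorLayoutsNonsingular`)
and of the eight conjectures implying it, written once so that every future «universal witness /
universal certificate» proposal for partition-minor layouts can be run through it.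

THE TEST LAYOUT. Rows `u_i` = (any `2^|T|` of the) subsets of `Fin h` of size `≤ s`; columns
`w_j` = ALL subsets of a block `T ⊆ Fin h`; `r = 2^|T|`.

**Theorem (`capacity_barrier`, `capacity_barrier_sets`).** Let `Φ U W ∈ ℂ` be ANY kernel (the layout
matrix entry a certificate / witness template produces on row-set `U` and column-set `W`). If the
functions `W ↦ Φ U W` (`W ⊆ T`), for all rows `U` of size `≤ s`, lie in the span of fewer than `r`
fixed functions `g_1, …, g_N` of `W` («the order-`≤ s` jets of the template span `< r` directions»),
then for EVERY layout with `r` rows of size `≤ s` and columns inside `T` the layout matrix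
`(Φ (u i) (w j))_{i,j}` is SINGULAR. (`det_eq_zero_of_rows_mem_span`: a square matrix whose rows lie
in a space of dimension `< r` has determinant `0`.)

**Corollary (`exists_dead_layout`).** If a template `θ ↦ Φ_θ` has capacity `N < 2^|T|` uniformly in its
parameter `θ` (the spanning functions may depend on `θ`, their NUMBER may not) and `Fin h` has at
least `2^|T|` subsets of size `≤ s`, then ONE injective layout (`r = 2^|T|`, rows of size `≤ s`, columns
= the subsets of `T`) is singular for EVERY `θ`: no universal certificate / witness of that template
exists. `partitionMinor_capacity_barrier` is the reading for item 19717's own matrix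
(`Φ_f U W = [x^U y^W] f`): a witness polynomial `f` whose order-`≤ s` `x`-jets, read on `y_T`, span
`< 2^|T|` directions misses the test layout.

**Instances, by name.**
* TNS (`s = 1`, capacity `1 + |T|²`, the count of `TNSRefutation.tns_det_eq_zero_of_singleton_rows`
  re-used): `principalMinor_dead_layout` (one injective layout dead for every `K` as soon as
  `|T|² + 1 < 2^|T| ≤ h + 1`) and `principalMinor_dead_at_thirtyone` (`|T| = 5`, `h = 31`, `r = 32`:
  the witness of `TNSRefutation.not_PrincipalMinorLayoutsNonsingular`, item 19126 closed `refuted`).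
* SCK, the symmetric Cauchy kernel `∏_{a∈U} ∏_c (s_a ∓ t_c)²` of this seat (p489988): a SECOND capacity
  mechanism — a singleton row is a polynomial of degree `≤ 2|T|` in `s_a`, so the capacity is
  `2|T| + 1` (`symmetricCauchy_capacity`, `symmetricCauchy_capacity_barrier`); dead layouts exist as soon
  as `2|T| + 1 < 2^|T| ≤ h + 1`, e.g. `h = 7`, `|T| = 3`, `r = 8` (`symmetricCauchy_dead_layout`,
  `symmetricCauchy_dead_at_seven`); hence `no_universal_symmetricCauchy_certificate` (the hypothesis of
  `SymmetricCauchy.principalMinorLayoutsNonsingular_of_symmetricCauchy`, p489988, is false) — proved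
  here WITHOUT passing through TNS. This file imports no route file (cone-free).
* Product-STATE witnesses / TWO-STATE doors (capacity `S·Σ_{j≤s} C(|T|,j)`, dead at
  `(s,|T|,h) = (2,7,16)` for `S ≤ 4` states): companion file `…CapacityBarrierProductStates.lean`.

SCOPE CAVEAT (what the barrier does NOT say). It needs `r = 2^|T|` columns with `2^|T|` exceeding the
capacity (so `r ≥ 8`, typically `r ≥ 16`), and it constrains only templates whose capacity is bounded
INDEPENDENTLY of the layout: layout-dependent witnesses (the quantifier order of item 19717 itself),
CHOW products `∏_k L_k(x,y)` with forms involving all variables (per-coordinate capacity `2h`, test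
layouts are hit numerically: rank `128/128` at `(2,7,16)`), and determinantal witnesses with
coefficient matrices of rank `≳ √h` are NOT obstructed. Nothing here bears on crux 14610 or `VP ≠ VNP`.
-/

set_option linter.dupNamespace false

open Matrix Finset

namespace Summit.ValiantsHypothesis.ValiantsHypothesis.Theorems.BarrierLever.CapacityBarrier

/-! ## 1. The abstract barrier: rows in a space of dimension `< r` -/

/-- **Rank form of the barrier.** If every row of a square matrix lies in the span of a family of
vectors indexed by a type of cardinality `<` the number of rows, the determinant vanishes. -/
theorem det_eq_zero_of_rows_mem_span {m ι : Type*} [Fintype m] [DecidableEq m] [Fintype ι]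
    (M : Matrix m m ℂ) (g : ι → m → ℂ) (hrow : ∀ i, M i ∈ Submodule.span ℂ (Set.range g))
    (hcard : Fintype.card ι < Fintype.card m) : M.det = 0 := by
  by_contra hdet
  have hunit : IsUnit M := (Matrix.isUnit_iff_isUnit_det M).2 (isUnit_iff_ne_zero.2 hdet)
  have hli : LinearIndependent ℂ M.row := Matrix.linearIndependent_rows_iff_isUnit.2 hunit
  have hc : Fintype.card m = (Set.range M.row).finrank ℂ :=
    linearIndependent_iff_card_eq_finrank_span.1 hli
  have hle : Submodule.span ℂ (Set.range M.row) ≤ Submodule.span ℂ (Set.range g) :=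
    Submodule.span_le.2 (by rintro _ ⟨i, rfl⟩; exact hrow i)
  have h1 : (Set.range M.row).finrank ℂ ≤ (Set.range g).finrank ℂ := Submodule.finrank_mono hle
  have h2 : (Set.range g).finrank ℂ ≤ Fintype.card ι := finrank_range_le_card g
  omega

/-- **The capacity barrier (predicate form).** `Φ a b` is any kernel on row labels `a` and column labels
`b`; `P` selects the admissible rows, `Q` the admissible columns. If on admissible columns every
admissible row `b ↦ Φ a b` is a linear combination of the `Fintype.card ι < r` functions `g t`, then
every `r × r` layout matrix with admissible rows and columns is singular. -/
theorem capacity_barrier {α β ι : Type*} [Fintype ι] (Φ : α → β → ℂ) (P : α → Prop) (Q : β → Prop)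
    (g : ι → β → ℂ) (hcap : ∀ a, P a → ∃ c : ι → ℂ, ∀ b, Q b → Φ a b = ∑ t, c t * g t b)
    {r : ℕ} (hcard : Fintype.card ι < r) (u : Fin r → α) (w : Fin r → β)
    (hu : ∀ i, P (u i)) (hw : ∀ j, Q (w j)) :
    (Matrix.of fun i j : Fin r => Φ (u i) (w j)).det = 0 := by
  classical
  refine det_eq_zero_of_rows_mem_span (Matrix.of fun i j : Fin r => Φ (u i) (w j))
    (fun t : ι => fun j : Fin r => g t (w j)) (fun i => ?_) (by simpa using hcard)
  obtain ⟨c, hc⟩ := hcap (u i) (hu i)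
  have hMi : (Matrix.of fun i j : Fin r => Φ (u i) (w j)) i =
      ∑ t, c t • (fun j : Fin r => g t (w j)) := by
    funext j
    simp only [Matrix.of_apply, Finset.sum_apply, Pi.smul_apply, smul_eq_mul]
    exact hc (w j) (hw j)
  rw [hMi]
  exact Submodule.sum_mem _ fun t _ => Submodule.smul_mem _ _ (Submodule.subset_span ⟨t, rfl⟩)

/-- **The capacity barrier for partition-minor layouts.** Rows = subsets `U ⊆ Fin h` of size `≤ s`,
columns = subsets `W` of a block `T`. If the functions `W ↦ Φ U W` (`W ⊆ T`) of all rows of size `≤ s`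
lie in the span of `Fintype.card ι < r` functions of `W`, every layout with `r` rows of size `≤ s`
and columns inside `T` has a SINGULAR layout matrix `(Φ (u i) (w j))`. -/
theorem capacity_barrier_sets {h r : ℕ} {ι : Type*} [Fintype ι]
    (Φ : Finset (Fin h) → Finset (Fin h) → ℂ) (s : ℕ) (T : Finset (Fin h))
    (g : ι → Finset (Fin h) → ℂ)
    (hcap : ∀ U : Finset (Fin h), U.card ≤ s → ∃ c : ι → ℂ, ∀ W, W ⊆ T → Φ U W = ∑ t, c t * g t W)
    (hcard : Fintype.card ι < r) (u w : Fin r → Finset (Fin h)) (hu : ∀ i, (u i).card ≤ s)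
    (hw : ∀ j, w j ⊆ T) : (Matrix.of fun i j : Fin r => Φ (u i) (w j)).det = 0 :=
  capacity_barrier Φ (fun U => U.card ≤ s) (fun W => W ⊆ T) g hcap hcard u w hu hw

/-- **The barrier read on item 19717's own matrix** (`PartitionMinorsHitByVP`): the entry is the
coefficient `[x^{u_i} y^{w_j}] f` of ONE witness polynomial `f` in the `h + h` variables `x` (first
block) and `y` (second block). If the order-`≤ s` `x`-jets `W ↦ [x^U y^W] f` (`|U| ≤ s`), read on the
block `y_T`, span fewer than `r` directions, `f` misses every layout with `r` rows of size `≤ s` and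
columns inside `T`. (Product-type witnesses have such bounded capacity; Chow products do not.) -/
theorem partitionMinor_capacity_barrier {h r : ℕ} {ι : Type*} [Fintype ι]
    (f : MvPolynomial (Fin (h + h)) ℂ) (s : ℕ) (T : Finset (Fin h)) (g : ι → Finset (Fin h) → ℂ)
    (hcap : ∀ U : Finset (Fin h), U.card ≤ s → ∃ c : ι → ℂ, ∀ W, W ⊆ T →
      MvPolynomial.coeff (∑ a ∈ U, Finsupp.single (Fin.castAdd h a) 1 +
        ∑ c ∈ W, Finsupp.single (Fin.natAdd h c) 1) f = ∑ t, c t * g t W)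
    (hcard : Fintype.card ι < r) (u w : Fin r → Finset (Fin h)) (hu : ∀ i, (u i).card ≤ s)
    (hw : ∀ j, w j ⊆ T) :
    (Matrix.of fun i j : Fin r => MvPolynomial.coeff (∑ a ∈ u i, Finsupp.single (Fin.castAdd h a) 1 +
      ∑ c ∈ w j, Finsupp.single (Fin.natAdd h c) 1) f).det = 0 :=
  capacity_barrier_sets (fun U W => MvPolynomial.coeff (∑ a ∈ U, Finsupp.single (Fin.castAdd h a) 1 +
    ∑ c ∈ W, Finsupp.single (Fin.natAdd h c) 1) f) s T g hcap hcard u w hu hw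

/-! ## 2. «Hence no universal certificate of the template exists»: one layout dead for all parameters -/

/-- The sets of size `≤ 1` in `Fin h` number at least `h + 1` (the empty set and the singletons). -/
theorem succ_le_card_filter_card_le_one (h : ℕ) :
    h + 1 ≤ ((Finset.univ : Finset (Finset (Fin h))).filter (fun U => U.card ≤ 1)).card := by
  classical
  let e : Option (Fin h) → Finset (Fin h) := fun o => o.elim ∅ (fun a => {a})
  have he : Function.Injective e := by
    intro o o' hoo'
    cases o with
    | none =>
      cases o' with
      | none => rfl
      | some a' => exact absurd hoo'.symm (Finset.singleton_ne_empty a')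
    | some a =>
      cases o' with
      | none => exact absurd hoo' (Finset.singleton_ne_empty a)
      | some a' => exact congrArg some (Finset.singleton_injective hoo')
  have hsub : (Finset.univ : Finset (Option (Fin h))).image e ⊆
      (Finset.univ : Finset (Finset (Fin h))).filter (fun U => U.card ≤ 1) := by
    intro U hU
    obtain ⟨o, -, rfl⟩ := Finset.mem_image.1 hU
    rw [Finset.mem_filter]
    refine ⟨Finset.mem_univ _, ?_⟩
    cases o with
    | none => simp [e]
    | some a => simp [e]
  calc h + 1 = ((Finset.univ : Finset (Option (Fin h))).image e).card := by
        rw [Finset.card_image_of_injective _ he, Finset.card_univ, Fintype.card_option,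
          Fintype.card_fin]
    _ ≤ _ := Finset.card_le_card hsub

/-- **The test layout exists.** If `Fin h` has at least `2^|T|` subsets of size `≤ s`, there are
`2^|T|` pairwise distinct rows of size `≤ s` and, as columns, the `2^|T|` (pairwise distinct) subsets
of `T`. -/
theorem exists_injective_layout {h : ℕ} (s : ℕ) (T : Finset (Fin h))
    (hrows : 2 ^ T.card ≤ ((Finset.univ : Finset (Finset (Fin h))).filter (fun U => U.card ≤ s)).card) :
    ∃ u w : Fin (2 ^ T.card) → Finset (Fin h), Function.Injective u ∧ Function.Injective w ∧
      (∀ i, (u i).card ≤ s) ∧ (∀ j, w j ⊆ T) := by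
  classical
  set 𝒮 := (Finset.univ : Finset (Finset (Fin h))).filter (fun U => U.card ≤ s) with h𝒮
  have hpow : T.powerset.card = 2 ^ T.card := Finset.card_powerset T
  let u : Fin (2 ^ T.card) → Finset (Fin h) := fun i => (𝒮.equivFin.symm (Fin.castLE hrows i)).1
  let w : Fin (2 ^ T.card) → Finset (Fin h) := fun j =>
    (T.powerset.equivFin.symm (Fin.cast hpow.symm j)).1
  have hu : ∀ i, (u i).card ≤ s := fun i =>
    (Finset.mem_filter.1 (𝒮.equivFin.symm (Fin.castLE hrows i)).2).2
  have hw : ∀ j, w j ⊆ T := fun j =>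
    Finset.mem_powerset.1 (T.powerset.equivFin.symm (Fin.cast hpow.symm j)).2
  refine ⟨u, w, ?_, ?_, hu, hw⟩
  · intro i i' hii'
    have h1 : 𝒮.equivFin.symm (Fin.castLE hrows i) = 𝒮.equivFin.symm (Fin.castLE hrows i') :=
      Subtype.ext hii'
    exact Fin.castLE_injective hrows (𝒮.equivFin.symm.injective h1)
  · intro j j' hjj'
    have h1 : T.powerset.equivFin.symm (Fin.cast hpow.symm j) =
        T.powerset.equivFin.symm (Fin.cast hpow.symm j') := Subtype.ext hjj'
    exact Fin.cast_injective hpow.symm (T.powerset.equivFin.symm.injective h1)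

/-- **No universal bounded-capacity certificate.** Let `θ ↦ Φ θ` be a template of kernels on
(row-set, column-set) whose capacity on (rows of size `≤ s`) × (subsets of `T`) is `≤ N < 2^|T|`
UNIFORMLY in `θ` (the `N` spanning functions may depend on `θ`). If `Fin h` has at least `2^|T|` subsets
of size `≤ s`, there is ONE injective layout — `r = 2^|T|` pairwise distinct rows of size `≤ s`, the
`2^|T|` subsets of `T` as columns — whose layout matrix is singular for EVERY `θ`. A universal
statement «every injective layout is certified by some `θ`» is therefore false for the template. -/
theorem exists_dead_layout {h : ℕ} {Θ : Type*} (Φ : Θ → Finset (Fin h) → Finset (Fin h) → ℂ)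
    (s : ℕ) (T : Finset (Fin h)) (N : ℕ) (hN : N < 2 ^ T.card)
    (hcap : ∀ θ, ∃ g : Fin N → Finset (Fin h) → ℂ, ∀ U : Finset (Fin h), U.card ≤ s →
      ∃ c : Fin N → ℂ, ∀ W, W ⊆ T → Φ θ U W = ∑ t, c t * g t W)
    (hrows : 2 ^ T.card ≤ ((Finset.univ : Finset (Finset (Fin h))).filter (fun U => U.card ≤ s)).card) :
    ∃ u w : Fin (2 ^ T.card) → Finset (Fin h), Function.Injective u ∧ Function.Injective w ∧
      (∀ i, (u i).card ≤ s) ∧ (∀ j, w j ⊆ T) ∧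
      ∀ θ, (Matrix.of fun i j : Fin (2 ^ T.card) => Φ θ (u i) (w j)).det = 0 := by
  obtain ⟨u, w, huinj, hwinj, hu, hw⟩ := exists_injective_layout s T hrows
  refine ⟨u, w, huinj, hwinj, hu, hw, fun θ => ?_⟩
  obtain ⟨g, hg⟩ := hcap θ
  exact capacity_barrier_sets (Φ θ) s T g hg (by simpa using hN) u w hu hw

/-! ## 3. Instance TNS (`s = 1`): the principal-minor template, count `1 + |T|²` re-used by name -/

/-- A finset of size `≤ 1` is empty or a singleton (the row hypothesis of
`TNSRefutation.tns_det_eq_zero_of_singleton_rows`). -/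
theorem eq_empty_or_singleton_of_card_le_one {h : ℕ} (U : Finset (Fin h)) (hU : U.card ≤ 1) :
    U = ∅ ∨ ∃ a, U = {a} := by
  rcases Nat.le_one_iff_eq_zero_or_eq_one.1 hU with h0 | h1
  · exact Or.inl (Finset.card_eq_zero.1 h0)
  · exact Or.inr (Finset.card_eq_one.1 h1)

/-- **TNS instance.** For the principal-minor template `Φ_K U W = det K[U ⊔ W̄]`
(`K ∈ ℂ^{(h+h)×(h+h)}`) singleton rows have capacity `1 + |T|²`
(`TNSRefutation.tns_det_eq_zero_of_singleton_rows`); so whenever `|T|² + 1 < 2^|T| ≤ h + 1` ONE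
injective layout (`2^|T|` rows of size `≤ 1`, the subsets of `T` as columns) is singular for EVERY `K`. -/
theorem principalMinor_dead_layout {h : ℕ} (T : Finset (Fin h))
    (hT : T.card * T.card + 1 < 2 ^ T.card) (hh : 2 ^ T.card ≤ h + 1) :
    ∃ u w : Fin (2 ^ T.card) → Finset (Fin h), Function.Injective u ∧ Function.Injective w ∧
      (∀ i, (u i).card ≤ 1) ∧ (∀ j, w j ⊆ T) ∧
      ∀ K : Matrix (Fin (h + h)) (Fin (h + h)) ℂ, (Matrix.of fun i j : Fin (2 ^ T.card) => (K.submatrix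
        (Subtype.val : ↥((u i).map (Fin.castAddEmb h) ∪ (w j).map (Fin.natAddEmb h)) → Fin (h + h))
        (Subtype.val : ↥((u i).map (Fin.castAddEmb h) ∪ (w j).map (Fin.natAddEmb h)) →
          Fin (h + h))).det).det = 0 := by
  obtain ⟨u, w, huinj, hwinj, hu, hw⟩ :=
    exists_injective_layout 1 T (le_trans hh (succ_le_card_filter_card_le_one h))
  exact ⟨u, w, huinj, hwinj, hu, hw, fun K => TNSRefutation.tns_det_eq_zero_of_singleton_rows K T u w
    (fun i => eq_empty_or_singleton_of_card_le_one (u i) (hu i)) hw hT⟩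

/-- **TNS dies at `h = 31`, `r = 32`** (`|T| = 5`: `26 < 32 ≤ 32`) — the dead layout behind
`TNSRefutation.not_PrincipalMinorLayoutsNonsingular` (item stmt-ValiantsHypothesis-19126, closed
`refuted`), obtained from the template. -/
theorem principalMinor_dead_at_thirtyone :
    ∃ u w : Fin (2 ^ ((Finset.univ : Finset (Fin 5)).map (Fin.castLEEmb (by norm_num : 5 ≤ 31))).card) →
      Finset (Fin 31), Function.Injective u ∧ Function.Injective w ∧
      (∀ i, (u i).card ≤ 1) ∧
      (∀ j, w j ⊆ (Finset.univ : Finset (Fin 5)).map (Fin.castLEEmb (by norm_num : 5 ≤ 31))) ∧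
      ∀ K : Matrix (Fin (31 + 31)) (Fin (31 + 31)) ℂ, (Matrix.of fun i j => (K.submatrix
        (Subtype.val : ↥((u i).map (Fin.castAddEmb 31) ∪ (w j).map (Fin.natAddEmb 31)) → Fin (31 + 31))
        (Subtype.val : ↥((u i).map (Fin.castAddEmb 31) ∪ (w j).map (Fin.natAddEmb 31)) →
          Fin (31 + 31))).det).det = 0 :=
  principalMinor_dead_layout _ (by simp) (by simp)

/-! ## 4. Instance SCK: the symmetric Cauchy kernel — capacity by DEGREE -/

/-- The column polynomial of the symmetric Cauchy template: `P_W(X) = ∏_{c ∈ T} (X ∓_W t_c)`,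
sign `-` for `c ∈ W`, `+` for `c ∉ W`; it is monic of degree `|T|`. -/
theorem colPoly_monic {h : ℕ} (t : Fin h → ℂ) (T W : Finset (Fin h)) :
    (∏ c ∈ T, (Polynomial.X - Polynomial.C (if c ∈ W then t c else -t c))).Monic :=
  Polynomial.monic_prod_of_monic _ _ fun _ _ => Polynomial.monic_X_sub_C _

/-- The column polynomial has degree `|T|`. -/
theorem colPoly_natDegree {h : ℕ} (t : Fin h → ℂ) (T W : Finset (Fin h)) :
    (∏ c ∈ T, (Polynomial.X - Polynomial.C (if c ∈ W then t c else -t c))).natDegree = T.card := by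
  rw [Polynomial.natDegree_prod_of_monic _ _ fun _ _ => Polynomial.monic_X_sub_C _]
  simp

/-- **SCK capacity.** A row of size `≤ 1` of the symmetric Cauchy template
`Φ U W = ∏_{a∈U} ∏_c (s_a ∓_W t_c)²` is, on the columns `W ⊆ T`, a linear combination of the
`2|T| + 1` coefficient functionals `W ↦ [X^k] P_W(X)²` (`k ≤ 2|T|`): the empty row is the leading
coefficient, a singleton row `{a}` is `(∏_{c∉T}(s_a+t_c)²)·P_W(s_a)²`, a polynomial of degree `2|T|`
in `s_a`. -/
theorem symmetricCauchy_capacity {h : ℕ} (s t : Fin h → ℂ) (T : Finset (Fin h)) (U : Finset (Fin h))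
    (hU : U.card ≤ 1) : ∃ c : Fin (2 * T.card + 1) → ℂ, ∀ W, W ⊆ T →
      (∏ a ∈ U, ∏ c : Fin h, (if c ∈ W then s a - t c else s a + t c) ^ 2) =
        ∑ k : Fin (2 * T.card + 1), c k *
          ((∏ c ∈ T, (Polynomial.X - Polynomial.C (if c ∈ W then t c else -t c))) ^ 2).coeff k := by
  classical
  rcases Nat.le_one_iff_eq_zero_or_eq_one.1 hU with h0 | h1
  · -- empty row: the leading coefficient
      have hU0 : U = ∅ := Finset.card_eq_zero.1 h0
      refine ⟨fun k => if (k : ℕ) = 2 * T.card then 1 else 0, fun W _ => ?_⟩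
      rw [hU0, Finset.prod_empty]
      rw [Finset.sum_eq_single (⟨2 * T.card, by omega⟩ : Fin (2 * T.card + 1)) (fun k _ hk => by
        have hk' : (k : ℕ) ≠ 2 * T.card := fun hk' => hk (Fin.ext hk')
        simp only [hk', if_false, zero_mul]) (fun hk => absurd (Finset.mem_univ _) hk)]
      simp only [if_true, one_mul]
      have hmon := ((colPoly_monic t T W).pow 2).coeff_natDegree
      have hdeg : ((∏ c ∈ T, (Polynomial.X - Polynomial.C (if c ∈ W then t c else -t c))) ^ 2).natDegree
          = 2 * T.card := by
        rw [(colPoly_monic t T W).natDegree_pow, colPoly_natDegree, mul_comm]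
      rw [hdeg] at hmon
      exact hmon.symm
  · -- singleton row `{a}`: evaluation of `P_W²` at `s a`, times the constant `∏_{c ∉ T} (s a + t c)²`
      obtain ⟨a, hU1⟩ := Finset.card_eq_one.1 h1
      refine ⟨fun k => (∏ c ∈ (Finset.univ : Finset (Fin h)) \ T, (s a + t c) ^ 2) * s a ^ (k : ℕ),
        fun W hW => ?_⟩
      rw [hU1, Finset.prod_singleton]
      -- split the product over `Fin h` into `T` and its complement
      have hsplit : (∏ c : Fin h, (if c ∈ W then s a - t c else s a + t c) ^ 2) =
          (∏ c ∈ T, (if c ∈ W then s a - t c else s a + t c) ^ 2) *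
            ∏ c ∈ (Finset.univ : Finset (Fin h)) \ T, (s a + t c) ^ 2 := by
        rw [← Finset.prod_sdiff (Finset.subset_univ T), mul_comm]
        congr 1
        refine Finset.prod_congr rfl fun c hc => ?_
        rw [if_neg (fun hcW => (Finset.mem_sdiff.1 hc).2 (hW hcW))]
      -- the product over `T` is the evaluation of `P_W²` at `s a`
      have heval : (∏ c ∈ T, (if c ∈ W then s a - t c else s a + t c) ^ 2) =
          ((∏ c ∈ T, (Polynomial.X - Polynomial.C (if c ∈ W then t c else -t c))) ^ 2).eval (s a) := by
        rw [Polynomial.eval_pow, Polynomial.eval_prod, ← Finset.prod_pow]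
        refine Finset.prod_congr rfl fun c _ => ?_
        split_ifs <;> simp [sub_eq_add_neg]
      have hdeg : ((∏ c ∈ T, (Polynomial.X - Polynomial.C (if c ∈ W then t c else -t c))) ^ 2).natDegree
          < 2 * T.card + 1 := by
        rw [(colPoly_monic t T W).natDegree_pow, colPoly_natDegree]; omega
      rw [hsplit, heval, Polynomial.eval_eq_sum_range' hdeg, Finset.sum_mul]
      simp only [Finset.sum_range]
      refine Finset.sum_congr rfl fun k _ => ?_
      ring

/-- **SCK capacity barrier.** Every layout with `r > 2|T| + 1` rows of size `≤ 1` and columns inside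
`T` has a singular symmetric-Cauchy layout matrix, for EVERY parameter `(s, t)`. -/
theorem symmetricCauchy_capacity_barrier {h r : ℕ} (s t : Fin h → ℂ) (T : Finset (Fin h))
    (u w : Fin r → Finset (Fin h)) (hu : ∀ i, (u i).card ≤ 1) (hw : ∀ j, w j ⊆ T)
    (hr : 2 * T.card + 1 < r) :
    (Matrix.of fun i j : Fin r =>
      ∏ a ∈ u i, ∏ c : Fin h, (if c ∈ w j then s a - t c else s a + t c) ^ 2).det = 0 :=
  capacity_barrier_sets
    (fun U W => ∏ a ∈ U, ∏ c : Fin h, (if c ∈ W then s a - t c else s a + t c) ^ 2) 1 T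
    (fun (k : Fin (2 * T.card + 1)) W =>
      ((∏ c ∈ T, (Polynomial.X - Polynomial.C (if c ∈ W then t c else -t c))) ^ 2).coeff k)
    (fun U hU => symmetricCauchy_capacity s t T U hU) (by simpa using hr) u w hu hw

/-- **SCK dead layouts.** Whenever `2|T| + 1 < 2^|T| ≤ h + 1` (e.g. `|T| = 3`, `h ≥ 7`) ONE injective
layout with `2^|T|` rows of size `≤ 1` and the subsets of `T` as columns is singular for every
parameter `(s, t)` of the symmetric Cauchy template. -/
theorem symmetricCauchy_dead_layout {h : ℕ} (T : Finset (Fin h)) (hT : 2 * T.card + 1 < 2 ^ T.card)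
    (hh : 2 ^ T.card ≤ h + 1) :
    ∃ u w : Fin (2 ^ T.card) → Finset (Fin h), Function.Injective u ∧ Function.Injective w ∧
      (∀ i, (u i).card ≤ 1) ∧ (∀ j, w j ⊆ T) ∧ ∀ θ : (Fin h → ℂ) × (Fin h → ℂ),
      (Matrix.of fun i j : Fin (2 ^ T.card) =>
        ∏ a ∈ u i, ∏ c : Fin h, (if c ∈ w j then θ.1 a - θ.2 c else θ.1 a + θ.2 c) ^ 2).det = 0 :=
  exists_dead_layout
    (fun (θ : (Fin h → ℂ) × (Fin h → ℂ)) U W =>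
      ∏ a ∈ U, ∏ c : Fin h, (if c ∈ W then θ.1 a - θ.2 c else θ.1 a + θ.2 c) ^ 2)
    1 T (2 * T.card + 1) hT
    (fun θ => ⟨fun k W => ((∏ c ∈ T, (Polynomial.X - Polynomial.C (if c ∈ W then θ.2 c else -θ.2 c))) ^ 2).coeff k,
      fun U hU => symmetricCauchy_capacity θ.1 θ.2 T U hU⟩)
    (le_trans hh (succ_le_card_filter_card_le_one h))

/-- **SCK dies at `h = 7`, `r = 8`** (rows `∅` and the seven singletons, columns the subsets of a
`3`-block): the numerical death of the symmetric Cauchy kernel conjecture found by this seat's census,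
now in the kernel. -/
theorem symmetricCauchy_dead_at_seven :
    ∃ u w : Fin (2 ^ ((Finset.univ : Finset (Fin 3)).map (Fin.castLEEmb (by norm_num : 3 ≤ 7))).card) →
      Finset (Fin 7), Function.Injective u ∧ Function.Injective w ∧
      (∀ i, (u i).card ≤ 1) ∧
      (∀ j, w j ⊆ (Finset.univ : Finset (Fin 3)).map (Fin.castLEEmb (by norm_num : 3 ≤ 7))) ∧
      ∀ θ : (Fin 7 → ℂ) × (Fin 7 → ℂ), (Matrix.of fun i j =>
        ∏ a ∈ u i, ∏ c : Fin 7, (if c ∈ w j then θ.1 a - θ.2 c else θ.1 a + θ.2 c) ^ 2).det = 0 :=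
  symmetricCauchy_dead_layout _ (by simp) (by simp)

/-- **SCK instance, item form.** The symmetric Cauchy kernel conjecture of this seat («every injective
layout has a nonsingular symmetric-Cauchy layout matrix for some `(s, t)`», the hypothesis of
`SymmetricCauchy.principalMinorLayoutsNonsingular_of_symmetricCauchy`, p489988) is FALSE — directly from
the dead layout at `h = 7`, without passing through TNS. -/
theorem no_universal_symmetricCauchy_certificate :
    ¬ (∀ (h r : ℕ) (u w : Fin r → Finset (Fin h)), Function.Injective u → Function.Injective w →
        ∃ s t : Fin h → ℂ, (Matrix.of fun i j : Fin r =>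
          ∏ a ∈ u i, ∏ c : Fin h, (if c ∈ w j then s a - t c else s a + t c) ^ 2).det ≠ 0) := by
  intro hSC
  obtain ⟨u, w, huinj, hwinj, -, -, hdead⟩ := symmetricCauchy_dead_at_seven
  obtain ⟨s, t, hst⟩ := hSC 7 _ u w huinj hwinj
  exact hst (hdead (s, t))

end Summit.ValiantsHypothesis.ValiantsHypothesis.Theorems.BarrierLever.CapacityBarrier
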